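import Mathlib
import HarnessLib
import Literature.NumberTheory.EllipticCurves.PastenCongruenceModulusSizeProofs

/-!
# Crux `ReceptacleIdentity` (stmt-ABC-1813), line `Sketch` — stub `stub_existsMonicNatDegree`

The Hecke core of the Hasse-window mechanism, with the DEGREE made explicit: the Hecke
operator `T_p` on `S_k(Γ₀(N))` is annihilated by a monic integer polynomial of degree
`rank_ℝ S_k(Γ₀(N))` all of whose complex roots obey any common bound for the eigenvalues of
`T_p`.  This is the tree's `exists_monic_aeval_heckeT_eq_zero(_norm_le)`
(`PastenCongruenceModulusSizeProofs.lean`; Shimura 1971, Thm. 3.48: the characteristic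
polynomial of the integer matrix of `T_p` on the `T_p`-stable lattice spanned by a real basis of
`S_k(Γ₀(N))`, `exists_heckeStable_realBasis`), whose statement hides the degree in an
existential; the proof below is the same argument, recording `deg = n = rank_ℝ`.
-/

noncomputable section

-- `Summit.ABC.ABC` is the mandated summit-side namespace (single-conjunct summit).
set_option linter.dupNamespace false

open scoped MatrixGroups ModularForm ComplexConjugate
open CongruenceSubgroup Polynomial
open Literature.NumberTheory.EllipticCurves.ModularForms

namespace Summit.ABC.ABC.Theorems.ReceptacleIdentitySketch

/-- **`T_p` satisfies a monic integer polynomial of degree `rank_ℝ S_k(Γ₀(N))` whose complex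
roots obey any eigenvalue bound.**  For `p` prime and `B` a bound for the norms of the
eigenvalues of `T_p = heckeT (Γ₀(N)) k p` on `S_k(Γ₀(N))`, there is a monic `q ∈ ℤ[X]` with
`deg q = rank_ℝ S_k(Γ₀(N))`, `q(T_p) = 0`, and `|μ| ≤ B` for every complex root `μ` of `q`.
Proof (Shimura 1971, Thm. 3.48, as in the tree's `exists_monic_aeval_heckeT_eq_zero`): take the
characteristic polynomial of the integer matrix `A` of `T_p` on the `ℤ`-span of a `T_p`-stable
real basis `b` of `S_k(Γ₀(N))` (`exists_heckeStable_realBasis`); Cayley–Hamilton kills `T_p`;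
its degree is the size of `b`, i.e. `rank_ℝ`; and a complex eigenvector `z` of `A` for a root
`μ` yields the `T_p`-eigenvectors `∑ zⱼ bⱼ` (for `μ`) and `∑ z̄ⱼ bⱼ` (for `μ̄`), not both zero, so
`|μ| = |μ̄| ≤ B`.  Registered stub of line `Sketch` for crux stmt-ABC-1813. -/
theorem stub_existsMonicNatDegree (N : ℕ) [NeZero N] (k : ℤ) (p : ℕ) [NeZero p] (hp : p.Prime)
    {B : ℝ} (hB : ∀ μ : ℂ, Module.End.HasEigenvalue (heckeT (Gamma0 N) k p) μ → ‖μ‖ ≤ B) :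
    ∃ q : ℤ[X], q.Monic ∧ q.natDegree = Module.finrank ℝ (CuspForm (Gamma0 N) k) ∧
      aeval (heckeT (Gamma0 N) k p) q = 0 ∧
      ∀ μ : ℂ, (q.map (Int.castRingHom ℂ)).IsRoot μ → ‖μ‖ ≤ B := by
  -- adapted from Literature/NumberTheory/EllipticCurves/PastenCongruenceModulusSizeProofs.lean
  -- (`exists_monic_aeval_heckeT_eq_zero`), keeping track of the degree of the polynomial
  obtain ⟨n, b, hb⟩ := exists_heckeStable_realBasis N k
  set T : Module.End ℂ (CuspForm (Gamma0 N) k) := heckeT (Gamma0 N) k p with hT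
  have hcol : ∀ j : Fin n, ∃ c : Fin n → ℤ, ∑ i, c i • b i = T (b j) := fun j ↦
    (Submodule.mem_span_range_iff_exists_fun ℤ).mp (hb p hp j)
  choose c hc using hcol
  obtain ⟨A, hTb⟩ : ∃ A : Matrix (Fin n) (Fin n) ℤ,
      ∀ j, T (b j) = ∑ i, ((A i j : ℤ) : ℂ) • b i := by
    refine ⟨Matrix.of fun i j ↦ c j i, fun j ↦ ?_⟩
    rw [← hc j]
    refine Finset.sum_congr rfl fun i _ ↦ ?_
    rw [Matrix.of_apply, Int.cast_smul_eq_zsmul]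
  refine ⟨A.charpoly, A.charpoly_monic, ?_, ?_, fun μ hμ ↦ ?_⟩
  · -- the degree is the size of the real basis
    rw [Matrix.charpoly_natDegree_eq_dim, Module.finrank_eq_card_basis b]
  · -- Cayley–Hamilton on the lattice, then extend `ℝ`-linearly
    have hbj : ∀ j, aeval T A.charpoly (b j) = 0 := fun j ↦ by
      rw [aeval_apply_eq_sum_of_apply_eq_sum b T A hTb, Matrix.aeval_self_charpoly]
      simp
    refine LinearMap.ext fun v ↦ ?_
    rw [LinearMap.zero_apply, ← b.sum_repr v, map_sum (aeval T A.charpoly)]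
    refine Finset.sum_eq_zero fun j _ ↦ ?_
    rw [(aeval T A.charpoly).map_smul_of_tower (b.repr v j) (b j), hbj, smul_zero]
  · -- a root `μ` of the characteristic polynomial: `μ` or `μ̄` is an eigenvalue of `T_p`
    obtain ⟨z, hz0, hz⟩ := exists_mulVec_eq_smul_of_isRoot_charpoly A hμ
    have hzi : ∀ i, ∑ j, ((A i j : ℤ) : ℂ) * z j = μ * z i := fun i ↦ by
      have := congrFun hz i
      simpa [Matrix.mulVec, dotProduct, Matrix.map_apply] using this
    -- the two candidate eigenvectors
    set v : CuspForm (Gamma0 N) k := ∑ j, z j • b j with hv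
    set v' : CuspForm (Gamma0 N) k := ∑ j, conj (z j) • b j with hv'
    have hTv : T v = μ • v := by
      rw [hv, map_sum, Finset.smul_sum]
      simp_rw [map_smul, hTb, Finset.smul_sum, smul_smul]
      rw [Finset.sum_comm]
      refine Finset.sum_congr rfl fun i _ ↦ ?_
      rw [← Finset.sum_smul, ← hzi i]
      congr 1
      exact Finset.sum_congr rfl fun j _ ↦ mul_comm _ _
    have hTv' : T v' = conj μ • v' := by
      rw [hv', map_sum, Finset.smul_sum]
      simp_rw [map_smul, hTb, Finset.smul_sum, smul_smul]
      rw [Finset.sum_comm]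
      refine Finset.sum_congr rfl fun i _ ↦ ?_
      rw [← Finset.sum_smul, ← map_mul, ← hzi i, map_sum]
      congr 1
      exact Finset.sum_congr rfl fun j _ ↦ by rw [map_mul, map_intCast, mul_comm]
    by_cases hv0 : v = 0
    · by_cases hv'0 : v' = 0
      · -- both vanish: then `z = 0`
        exfalso
        apply hz0
        have hind := Fintype.linearIndependent_iff.mp b.linearIndependent
        have hre : ∀ j, 2 * (z j).re = 0 := by
          refine hind (fun j ↦ 2 * (z j).re) ?_
          have : v + v' = 0 := by rw [hv0, hv'0, add_zero]
          rw [hv, hv', ← Finset.sum_add_distrib] at this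
          rw [← this]
          refine Finset.sum_congr rfl fun j _ ↦ ?_
          rw [← add_smul, Complex.add_conj, Complex.coe_smul]
        have him : ∀ j, 2 * (z j).im = 0 := by
          refine hind (fun j ↦ 2 * (z j).im) ?_
          have : v - v' = 0 := by rw [hv0, hv'0, sub_zero]
          rw [hv, hv', ← Finset.sum_sub_distrib] at this
          have hI : Complex.I • ∑ j, (2 * (z j).im) • b j = 0 := by
            rw [← this, Finset.smul_sum]
            refine Finset.sum_congr rfl fun j _ ↦ ?_
            rw [← sub_smul, Complex.sub_conj, ← Complex.coe_smul, smul_smul, mul_comm]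
          exact (smul_eq_zero.mp hI).resolve_left Complex.I_ne_zero
        funext j
        apply Complex.ext
        · simpa using hre j
        · simpa using him j
      · have hev : Module.End.HasEigenvalue T (conj μ) :=
          Module.End.hasEigenvalue_of_hasEigenvector
            ⟨Module.End.mem_eigenspace_iff.mpr hTv', hv'0⟩
        rw [← Complex.norm_conj]
        exact hB _ hev
    · exact hB μ (Module.End.hasEigenvalue_of_hasEigenvector
        ⟨Module.End.mem_eigenspace_iff.mpr hTv, hv0⟩)

end Summit.ABC.ABC.Theorems.ReceptacleIdentitySketch
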